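import Literature.Analysis.FluidPDE.CompressibleEulerImplosionCentreExpansionWindow2
import Literature.Analysis.ValidatedNumerics.TaylorModel
import HarnessLib

/-!
# Buckmaster–Cao-Labora–Gómez-Serrano at `γ = 5/3`: Taylor models in `ζ` of the centre series and its `x`-derivatives

Companion of `…CentreCoeffWindow2` (the `r`-uniform coefficient enclosures `bndsW2` of `w₀, …, w₆₀` on the
shooting window `r ∈ [13890041/12500000, 697/625]`), `…OriginSeriesGrowth` (`|w_j|(j+1)² ≤ λʲ`, `λ = 73/25`) and
`…CentreExpansionWindow2` (the series profile `Wser`, `Sser` of the crux `DenseExcursion`, line `sonic-cavity-renewal`).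
Deep inside the disc of convergence every quantity of the pinned profile is a power series in `ζ = c eˣ` whose
coefficients are known up to the small `r`-uniform intervals `bndsW2`; this file packages the six series

  `W^{(m)}(x) = Σ_j j^m a_j ζ^j` (`a_j = −w_{j+1}`, `j` even),  `c·(eˣS)^{(m)}(x) = Σ_j j^m w_j ζ^j / 3` (`j` even),

`m = 0, 1, 2`, as functions `fW r m`, `fU r m` of `ζ` and proves that they are enclosed (`TMem`, the Taylor-model
semantics of `Literature/Analysis/ValidatedNumerics/TaylorModel.lean`) by the KERNEL-COMPUTABLE interval polynomials
`tmW m n h`, `tmU m n h`: the first `n` coefficients read off `bndsW2`, the geometric tail `λ^{n+1}hⁿ/(1 − λh)` folded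
into the constant coefficient. Together with the sign checker `posOn` this turns every polynomial inequality between
`W, W′, W″, S, S′, S″` on a `ζ`-range into one `decide` (`pos_of_tmem_posOn`). No facts, no axioms.

[cite: BuckmasterCaolaboraGomezserrano2025, Prop. 2.5, eq. (2.12), App. B]
-/

noncomputable section

open Finset

namespace Literature.Analysis.FluidPDE

namespace BuckmasterCaolaboraGomezserrano2025

namespace OriginSeries

namespace CentreW2

open Literature.Analysis.ValidatedNumerics Literature.Analysis.ValidatedNumerics.PolyMP
open Literature.Analysis.ValidatedNumerics.NumericsMP Literature.Analysis.ValidatedNumerics.Numerics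

set_option linter.style.longLine false
set_option linter.style.setOption false

/-! ### Kernel side: the interval data -/

/-- Scale of the fixed-point intervals (`2⁶⁰`). [folklore] -/
def SB : ℕ := 2 ^ 60

/-- [folklore] -/
theorem SB_pos : 0 < SB := by unfold SB; positivity

/-- The interval `[lo, hi]` of two rationals, outward rounded to scale `SB`. [folklore] -/
def ivl (lo hi : ℚ) : MI := MI.span (ofRat SB lo) (ofRat SB hi)

/-- [folklore] -/
theorem mem_ivl {lo hi : ℚ} {x : ℝ} (h1 : (lo : ℝ) ≤ x) (h2 : x ≤ hi) : MI.mem SB x (ivl lo hi) :=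
  MI.mem_span (mem_ofRat SB lo) (mem_ofRat SB hi) h1 h2

/-- The interval of the coefficient `w_j` on the window (`bndsW2[j]`). [folklore] -/
def wI (j : ℕ) : MI := ivl (bndsW2.getD j (0, 0)).1 (bndsW2.getD j (0, 0)).2

/-- [folklore] -/
theorem mem_wI {r : ℝ} (hr : r ∈ Set.Icc ((13890041/12500000 : ℚ) : ℝ) ((697/625 : ℚ) : ℝ)) {j : ℕ} (hj : j ≤ 60) :
    MI.mem SB (w r 1 j) (wI j) :=
  mem_ivl (centre_coeff_boundsW2 hr hj).1 (centre_coeff_boundsW2 hr hj).2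

/-- The thin zero interval. [folklore] -/
def zI : MI := MI.ofInt SB 0

/-- [folklore] -/
theorem mem_zI : MI.mem SB 0 zI := by
  have h := MI.mem_ofInt SB 0
  unfold zI; exact_mod_cast h

/-- Interval of the coefficient `j^m a_j`, `a_j = −w_{j+1}` (`j` even), of `W^{(m)}`. [folklore] -/
def coefW (m j : ℕ) : MI := if j % 2 = 0 then MI.mulInt (MI.neg (wI (j + 1))) ((j ^ m : ℕ) : ℤ) else zI

/-- Interval of the coefficient `j^m w_j / 3` (`j` even) of `c·(eˣS)^{(m)}`. [folklore] -/
def coefU (m j : ℕ) : MI := if j % 2 = 0 then MI.divNat (MI.mulInt (wI j) ((j ^ m : ℕ) : ℤ)) 3 else zI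

/-- The first `n` coefficient intervals of `W^{(m)}`. [folklore] -/
def headW (m n : ℕ) : IPoly := (List.range n).map (coefW m)

/-- The first `n` coefficient intervals of `c·(eˣS)^{(m)}`. [folklore] -/
def headU (m n : ℕ) : IPoly := (List.range n).map (coefU m)

/-- Integer ceiling of a rational. [folklore] -/
def qceil (q : ℚ) : ℤ := cdiv q.num q.den

/-- [folklore] -/
theorem le_qceil (q : ℚ) : (q : ℝ) ≤ (qceil q : ℝ) := by
  rw [ratCast_eq_num_div_den]; exact div_le_cdiv (by exact_mod_cast q.pos)

/-- Scaled bound of the geometric tail `λ^{n+1} hⁿ / (1 − λh)` beyond the first `n` coefficients. [folklore] -/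
def tailB (n : ℕ) (h : ℚ) : ℤ := qceil (lamQ ^ (n + 1) * h ^ n / (1 - lamQ * h) * SB)

/-- The Taylor model of `W^{(m)}`: `n` head coefficients, the tail folded into the constant one. [folklore] -/
def tmW (m n : ℕ) (h : ℚ) : IPoly := widen0 (headW m n) (tailB n h)

/-- The Taylor model of `c·(eˣS)^{(m)}`. [folklore] -/
def tmU (m n : ℕ) (h : ℚ) : IPoly := widen0 (headU m n) (tailB n h)

/-! ### Real side: the coefficients and the six series as functions of `ζ` -/

/-- Coefficient `j^m a_j` of `W^{(m)}`. [folklore] -/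
def cW (r : ℝ) (m j : ℕ) : ℝ := ((j ^ m : ℕ) : ℝ) * aW r j

/-- Coefficient `w_j/3` (`j` even, else `0`) of `c·eˣS = Σ w_j ζ^j/3`. [folklore] -/
def aU (r : ℝ) (j : ℕ) : ℝ := if j % 2 = 0 then w r 1 j / 3 else 0

/-- Coefficient `j^m w_j/3` of `c·(eˣS)^{(m)}`. [folklore] -/
def cU (r : ℝ) (m j : ℕ) : ℝ := ((j ^ m : ℕ) : ℝ) * aU r j

/-- `W^{(m)}` as a function of `ζ`: `Σ_j j^m a_j ζ^j`. [folklore] -/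
def fW (r : ℝ) (m : ℕ) (ζ : ℝ) : ℝ := ∑' j, cW r m j * ζ ^ j

/-- `c·(eˣS)^{(m)}` as a function of `ζ`: `Σ_j j^m w_j ζ^j / 3`. [folklore] -/
def fU (r : ℝ) (m : ℕ) (ζ : ℝ) : ℝ := ∑' j, cU r m j * ζ ^ j

variable {r : ℝ}

/-- `aS = aU / c`. [folklore] -/
theorem aS_eq_aU_div {c : ℝ} (j : ℕ) : aS r c j = aU r j / c := by
  unfold aS aU; split_ifs <;> [field_simp; simp]

/-- `j^m ≤ (j+1)²·` and `|w_{j+1}|(j+2)² ≤ λ^{j+1}` give `|j^m a_j| ≤ λ^{j+1}` for `m ≤ 2`. [folklore] -/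
theorem abs_cW_le (hr : r ∈ Set.Icc ((13890041/12500000 : ℚ) : ℝ) ((697/625 : ℚ) : ℝ)) {m : ℕ} (hm : m ≤ 2) (j : ℕ) :
    |cW r m j| ≤ (73 / 25 : ℝ) ^ (j + 1) := by
  unfold cW aW
  split_ifs
  · have hw := abs_w_weight_le hr (j + 1)
    have hj0 : (0 : ℝ) ≤ j := Nat.cast_nonneg j
    have hjm : ((j ^ m : ℕ) : ℝ) ≤ ((j : ℝ) + 1) ^ 2 := by
      have h1 : ((j ^ m : ℕ) : ℝ) ≤ ((j + 1) ^ m : ℕ) := by exact_mod_cast Nat.pow_le_pow_left (Nat.le_succ j) m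
      have h2 : (((j + 1) ^ m : ℕ) : ℝ) ≤ (((j + 1) ^ 2 : ℕ) : ℝ) := by
        exact_mod_cast Nat.pow_le_pow_right (Nat.succ_pos j) hm
      push_cast at h1 h2 ⊢; linarith
    have hj2 : ((j : ℝ) + 1) ^ 2 ≤ (((j + 1 : ℕ) : ℝ) + 1) ^ 2 := by push_cast; nlinarith
    rw [abs_mul, abs_neg, abs_of_nonneg (by positivity : (0 : ℝ) ≤ ((j ^ m : ℕ) : ℝ))]
    calc ((j ^ m : ℕ) : ℝ) * |w r 1 (j + 1)| ≤ (((j + 1 : ℕ) : ℝ) + 1) ^ 2 * |w r 1 (j + 1)| := by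
          gcongr; exact hjm.trans hj2
      _ = |w r 1 (j + 1)| * (((j + 1 : ℕ) : ℝ) + 1) ^ 2 := by ring
      _ ≤ _ := hw
  · rw [mul_zero, abs_zero]; positivity

/-- `|j^m w_j / 3| ≤ λ^{j+1}` for `m ≤ 2`. [folklore] -/
theorem abs_cU_le (hr : r ∈ Set.Icc ((13890041/12500000 : ℚ) : ℝ) ((697/625 : ℚ) : ℝ)) {m : ℕ} (hm : m ≤ 2) (j : ℕ) :
    |cU r m j| ≤ (73 / 25 : ℝ) ^ (j + 1) := by
  unfold cU aU
  split_ifs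
  · have hw := abs_w_weight_le hr j
    have hjm : ((j ^ m : ℕ) : ℝ) ≤ ((j : ℝ) + 1) ^ 2 := by
      have h1 : ((j ^ m : ℕ) : ℝ) ≤ ((j + 1) ^ m : ℕ) := by exact_mod_cast Nat.pow_le_pow_left (Nat.le_succ j) m
      have h2 : (((j + 1) ^ m : ℕ) : ℝ) ≤ (((j + 1) ^ 2 : ℕ) : ℝ) := by
        exact_mod_cast Nat.pow_le_pow_right (Nat.succ_pos j) hm
      push_cast at h1 h2 ⊢; linarith
    have hl : (73 / 25 : ℝ) ^ j ≤ (73 / 25 : ℝ) ^ (j + 1) := pow_le_pow_right₀ (by norm_num) (Nat.le_succ j)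
    rw [abs_mul, abs_div, abs_of_nonneg (by positivity : (0 : ℝ) ≤ ((j ^ m : ℕ) : ℝ)), abs_of_pos (by norm_num : (0 : ℝ) < 3)]
    calc ((j ^ m : ℕ) : ℝ) * (|w r 1 j| / 3) ≤ ((j : ℝ) + 1) ^ 2 * (|w r 1 j| / 1) := by
          gcongr; norm_num
      _ = |w r 1 j| * ((j : ℝ) + 1) ^ 2 := by ring
      _ ≤ (73 / 25 : ℝ) ^ j := hw
      _ ≤ _ := hl
  · rw [mul_zero, abs_zero]; positivity

/-! ### Generic pieces: geometric tails, mapped ranges -/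

/-- **Geometric tail estimate.** If `|f_j| ≤ C θʲ` with `0 ≤ θ < 1` then `f` is summable and
`|Σ f − Σ_{j<n} f_j| ≤ C θⁿ/(1 − θ)`. [folklore] -/
theorem abs_tsum_sub_sum_le {f : ℕ → ℝ} {C θ : ℝ} (hθ0 : 0 ≤ θ) (hθ1 : θ < 1) (hf : ∀ j, |f j| ≤ C * θ ^ j) (n : ℕ) :
    Summable f ∧ |∑' j, f j - ∑ j ∈ range n, f j| ≤ C * θ ^ n / (1 - θ) := by
  have hC : 0 ≤ C := by have := (abs_nonneg _).trans (hf 0); simpa using this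
  have hg : Summable (fun j => C * θ ^ j) := (summable_geometric_of_lt_one hθ0 hθ1).mul_left C
  have hs : Summable f := Summable.of_norm_bounded hg (fun j => by rw [Real.norm_eq_abs]; exact hf j)
  refine ⟨hs, ?_⟩
  rw [← hs.sum_add_tsum_nat_add n, add_sub_cancel_left]
  have h1 : HasSum (fun j => f (j + n)) (∑' j, f (j + n)) := ((summable_nat_add_iff n).mpr hs).hasSum
  have h2 : HasSum (fun j => C * θ ^ n * θ ^ j) (C * θ ^ n * (1 - θ)⁻¹) :=
    (hasSum_geometric_of_lt_one hθ0 hθ1).mul_left (C * θ ^ n)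
  rw [div_eq_mul_inv]
  refine abs_le_of_hasSum_le h1 h2 fun j => ?_
  calc |f (j + n)| ≤ C * θ ^ (j + n) := hf (j + n)
    _ = C * θ ^ n * θ ^ j := by rw [pow_add]; ring

/-- `evalR (l ++ [a]) x = evalR l x + x^{|l|} a`. [folklore] -/
theorem evalR_append_singleton : ∀ (l : List ℝ) (a x : ℝ), evalR (l ++ [a]) x = evalR l x + x ^ l.length * a
  | [], a, x => by simp
  | b :: l, a, x => by
      simp only [List.cons_append, evalR_cons, evalR_append_singleton l a x, List.length_cons, pow_succ]; ring

/-- Horner evaluation of a mapped range is the finite power sum. [folklore] -/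
theorem evalR_map_range (f : ℕ → ℝ) (x : ℝ) : ∀ n : ℕ, evalR ((List.range n).map f) x = ∑ j ∈ range n, f j * x ^ j
  | 0 => by simp
  | n + 1 => by
      rw [List.range_succ, List.map_append, List.map_singleton, evalR_append_singleton, evalR_map_range f x n,
        List.length_map, List.length_range, sum_range_succ]; ring

/-- Coefficientwise membership of two mapped ranges. [folklore] -/
theorem pmem_map_range {S : ℕ} {f : ℕ → ℝ} {g : ℕ → MI} {n : ℕ} (h : ∀ j, j < n → MI.mem S (f j) (g j)) :
    PMem S ((List.range n).map f) ((List.range n).map g) := by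
  unfold PMem
  rw [List.forall₂_map_left_iff, List.forall₂_map_right_iff, List.forall₂_same]
  intro j hj; exact h j (List.mem_range.mp hj)

/-- **From a Taylor model and a kernel sign check to positivity.** [folklore] -/
theorem pos_of_tmem_posOn {S : ℕ} (hS : 0 < S) {h : ℚ} {f : ℝ → ℝ} {P : IPoly} (hf : TMem S h f P) {d : ℕ} {lo hi : ℚ}
    (hpos : posOn S d P lo hi = true) (hle : lo ≤ hi) {x : ℝ} (hxh : |x| ≤ h) (h1 : (lo : ℝ) ≤ x) (h2 : x ≤ hi) :
    0 < f x := by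
  obtain ⟨as, has, hev⟩ := hf x hxh
  rw [hev]; exact posOn_sound hS hpos hle has h1 h2

/-- Taylor-model membership only depends on the values of the function. [folklore] -/
theorem tmem_congr {S : ℕ} {h : ℚ} {f g : ℝ → ℝ} {P : IPoly} (hf : TMem S h f P) (hfg : ∀ x, f x = g x) :
    TMem S h g P := fun ρ hρ => by
  obtain ⟨as, has, hev⟩ := hf ρ hρ
  exact ⟨as, has, by rw [← hfg, hev]⟩

/-! ### Membership of the coefficients -/

/-- [folklore] -/
theorem mem_coefW (hr : r ∈ Set.Icc ((13890041/12500000 : ℚ) : ℝ) ((697/625 : ℚ) : ℝ)) (m : ℕ) {j : ℕ} (hj : j + 1 ≤ 60) :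
    MI.mem SB (cW r m j) (coefW m j) := by
  unfold cW coefW aW
  by_cases hp : j % 2 = 0
  · rw [if_pos hp, if_pos hp]
    have h := MI.mem_mulInt (MI.mem_neg (mem_wI hr hj)) ((j ^ m : ℕ) : ℤ)
    convert h using 1; push_cast; ring
  · rw [if_neg hp, if_neg hp, mul_zero]; exact mem_zI

/-- [folklore] -/
theorem mem_coefU (hr : r ∈ Set.Icc ((13890041/12500000 : ℚ) : ℝ) ((697/625 : ℚ) : ℝ)) (m : ℕ) {j : ℕ} (hj : j ≤ 60) :
    MI.mem SB (cU r m j) (coefU m j) := by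
  unfold cU coefU aU
  by_cases hp : j % 2 = 0
  · rw [if_pos hp, if_pos hp]
    have h := MI.mem_divNat (MI.mem_mulInt (mem_wI hr hj) ((j ^ m : ℕ) : ℤ)) (n := 3) (by norm_num)
    convert h using 1; push_cast; ring
  · rw [if_neg hp, if_neg hp, mul_zero]; exact mem_zI

/-- [folklore] -/
theorem pmem_headW (hr : r ∈ Set.Icc ((13890041/12500000 : ℚ) : ℝ) ((697/625 : ℚ) : ℝ)) (m : ℕ) {n : ℕ} (hn : n ≤ 60) :
    PMem SB ((List.range n).map (cW r m)) (headW m n) :=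
  pmem_map_range fun j hj => mem_coefW hr m (by omega)

/-- [folklore] -/
theorem pmem_headU (hr : r ∈ Set.Icc ((13890041/12500000 : ℚ) : ℝ) ((697/625 : ℚ) : ℝ)) (m : ℕ) {n : ℕ} (hn : n ≤ 61) :
    PMem SB ((List.range n).map (cU r m)) (headU m n) :=
  pmem_map_range fun j hj => mem_coefU hr m (by omega)

/-! ### The Taylor models enclose the series -/

/-- [folklore] -/
theorem lamQ_mul_cast (h : ℚ) : (((lamQ * h : ℚ)) : ℝ) = 73 / 25 * (h : ℝ) := by push_cast; rw [lamQ_cast]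

/-- The real tail constant is below the kernel integer `tailB`. [folklore] -/
theorem tail_le_tailB {h : ℚ} (n : ℕ) :
    (73 / 25 : ℝ) ^ (n + 1) * (h : ℝ) ^ n / (1 - 73 / 25 * (h : ℝ)) * SB ≤ (tailB n h : ℝ) := by
  have := le_qceil (lamQ ^ (n + 1) * h ^ n / (1 - lamQ * h) * SB)
  unfold tailB
  push_cast at this
  rw [lamQ_cast] at this
  exact this

/-- Common core of the two enclosure theorems. [folklore] -/
theorem tmem_of_coeff_bound {a : ℕ → ℝ} {head : IPoly} {n : ℕ} {h : ℚ} (h0 : 0 ≤ h) (hlam : lamQ * h < 1)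
    (ha : ∀ j, |a j| ≤ (73 / 25 : ℝ) ^ (j + 1)) (hhead : PMem SB ((List.range n).map a) head) :
    TMem SB h (fun ζ => ∑' j, a j * ζ ^ j) (widen0 head (tailB n h)) := by
  intro ζ hζ
  have hh : ((h : ℚ) : ℝ) < 25 / 73 := by
    have : (((lamQ * h : ℚ)) : ℝ) < 1 := by exact_mod_cast hlam
    rw [lamQ_mul_cast] at this; linarith
  have hθ0 : 0 ≤ 73 / 25 * |ζ| := by positivity
  have hθ1 : 73 / 25 * |ζ| < 1 := by nlinarith [abs_nonneg ζ]
  have hf : ∀ j, |a j * ζ ^ j| ≤ 73 / 25 * (73 / 25 * |ζ|) ^ j := fun j => by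
    rw [abs_mul, abs_pow, mul_pow]
    have := ha j
    rw [pow_succ] at this
    calc |a j| * |ζ| ^ j ≤ (73 / 25 : ℝ) ^ j * (73 / 25) * |ζ| ^ j := by gcongr
      _ = _ := by ring
  obtain ⟨-, htail⟩ := abs_tsum_sub_sum_le hθ0 hθ1 hf n
  set δ : ℝ := ∑' j, a j * ζ ^ j - ∑ j ∈ range n, a j * ζ ^ j with hδ
  have hδB : |δ| * SB ≤ (tailB n h : ℝ) := by
    refine le_trans ?_ (tail_le_tailB n)
    have hS : (0 : ℝ) ≤ SB := by positivity
    refine mul_le_mul_of_nonneg_right (htail.trans ?_) hS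
    have hz : |ζ| ≤ (h : ℝ) := hζ
    have hden : 0 < 1 - 73 / 25 * (h : ℝ) := by linarith
    have hden' : 0 < 1 - 73 / 25 * |ζ| := by linarith
    rw [div_le_div_iff₀ hden' hden]
    have e1 : (73 / 25 : ℝ) * (73 / 25 * |ζ|) ^ n = (73 / 25 : ℝ) ^ (n + 1) * |ζ| ^ n := by rw [mul_pow, pow_succ]; ring
    rw [e1]
    have hp : |ζ| ^ n ≤ (h : ℝ) ^ n := pow_le_pow_left₀ (abs_nonneg ζ) hz n
    have hq : 1 - 73 / 25 * (h : ℝ) ≤ 1 - 73 / 25 * |ζ| := by linarith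
    have hpos : (0 : ℝ) ≤ (73 / 25 : ℝ) ^ (n + 1) := by positivity
    calc (73 / 25 : ℝ) ^ (n + 1) * |ζ| ^ n * (1 - 73 / 25 * (h : ℝ))
        ≤ (73 / 25 : ℝ) ^ (n + 1) * (h : ℝ) ^ n * (1 - 73 / 25 * (h : ℝ)) := by gcongr
      _ ≤ (73 / 25 : ℝ) ^ (n + 1) * (h : ℝ) ^ n * (1 - 73 / 25 * |ζ|) := by gcongr
  obtain ⟨bs, hbs, hev⟩ := exists_widen0 hhead hδB ζ
  refine ⟨bs, hbs, ?_⟩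
  rw [hev, evalR_map_range, hδ]; ring

/-- **Enclosure of `W^{(m)}`** (`m ≤ 2`, `n ≤ 59` head coefficients, `λh < 1`). [cite: BuckmasterCaolaboraGomezserrano2025, Prop. 2.5, App. B] -/
theorem tmem_fW (hr : r ∈ Set.Icc ((13890041/12500000 : ℚ) : ℝ) ((697/625 : ℚ) : ℝ)) {m n : ℕ} (hm : m ≤ 2) (hn : n ≤ 59)
    {h : ℚ} (h0 : 0 ≤ h) (hlam : lamQ * h < 1) : TMem SB h (fW r m) (tmW m n h) :=
  tmem_of_coeff_bound h0 hlam (abs_cW_le hr hm) (pmem_headW hr m (by omega))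

/-- **Enclosure of `c·(eˣS)^{(m)}`** (`m ≤ 2`, `n ≤ 61`, `λh < 1`). [cite: BuckmasterCaolaboraGomezserrano2025, Prop. 2.5, App. B] -/
theorem tmem_fU (hr : r ∈ Set.Icc ((13890041/12500000 : ℚ) : ℝ) ((697/625 : ℚ) : ℝ)) {m n : ℕ} (hm : m ≤ 2) (hn : n ≤ 61)
    {h : ℚ} (h0 : 0 ≤ h) (hlam : lamQ * h < 1) : TMem SB h (fU r m) (tmU m n h) :=
  tmem_of_coeff_bound h0 hlam (abs_cU_le hr hm) (pmem_headU hr m hn)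

/-- A one-line kernel smoke test of the data path (`bndsW2 → coefU → tmU`): the constant coefficient of `c·eˣS` is `1/3`. [folklore] -/
theorem tmU_smoke : 0 < (tlowerI SB (1 / 5) (tmU 0 8 (1 / 5))) := by decide +kernel

end CentreW2

end OriginSeries

end BuckmasterCaolaboraGomezserrano2025

end Literature.Analysis.FluidPDE
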